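import Mathlib
import HarnessLib
import Summits.CriticalPhenomena.PercolationContinuityZ3.Theses.PercShatteringRace

/-!
# Sketch — crux-ideate stmt-CriticalPhenomena-5785 (`NearLinearTwoClusterDecay` = U(1/6)), ideator 3

First-lemma signatures for the idea cards (they need only elaborate; nothing here is proved except
the read-back `crux_iff` that the local event encoding is the route's).
-/

namespace Summit.CriticalPhenomena.PercolationContinuityZ3.Cruxes.NearLinearTwoClusterDecay.Sketch

open MeasureTheory Filter Topology
open Literature.Probability.LatticeModels Literature.Probability.Percolation
open Summit.CriticalPhenomena.PercolationContinuityZ3.Theses.PercShatteringRace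

noncomputable section

/-- Critical bond percolation on `ℤ³`. -/
abbrev Pc : Measure (BondConfig (Site 3)) := bondPercolation (zdGraph 3) (criticalProbI 3)

/-- The sphere `{‖x‖∞ = r}` = inner vertex boundary of `Λ_r`. -/
abbrev sphere (r : ℕ) : Finset (Site 3) := innerBoundary (zdGraph 3) (box 3 r)

/-- The closed shell `S(r,R) = {r ≤ ‖x‖∞ ≤ R}`: `Λ_R` minus the interior of `Λ_r`. -/
def shell (r R : ℕ) : Set (Site 3) :=
  (↑(box 3 R) : Set (Site 3)) \ ((↑(box 3 r) : Set (Site 3)) \ ↑(sphere r))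

/-- `B(r,R)`: the configuration restricted to the shell `S(r,R)` (free b.c.: paths inside the shell)
contains two DISTINCT open clusters each meeting both spheres. -/
def TwoShellClusters (r R : ℕ) : Set (BondConfig (Site 3)) :=
  {ω | ∃ x ∈ sphere r, ∃ x' ∈ sphere r, ∃ y ∈ sphere R, ∃ y' ∈ sphere R,
      ω ∈ openConnIn (shell r R) x y ∧ ω ∈ openConnIn (shell r R) x' y' ∧
        ω ∉ openConnIn (shell r R) x x'}

/-- The route's two-cluster event with general outer radius `m`: two distinct open clusters of
`Λ_m` each meeting `Λ_n` and `∂ⁱⁿΛ_m` (`A₂(n,m)` of van den Berg–van Engelenburg / Cerf, bond version). -/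
def TwoBoxClusters (n m : ℕ) : Set (BondConfig (Site 3)) :=
  {ω | ∃ x ∈ box 3 n, ∃ x' ∈ box 3 n, ∃ y ∈ sphere m, ∃ y' ∈ sphere m,
      ω ∈ openConnIn ↑(box 3 m) x y ∧ ω ∈ openConnIn ↑(box 3 m) x' y' ∧ ω ∉ openConnIn ↑(box 3 m) x x'}

/-- Read-back: the crux is literally `P(A₂(n, ⌈n^{7/6}⌉)) → 0` in this encoding. -/
theorem crux_iff :
    NearLinearTwoClusterDecay ↔
      Tendsto (fun n : ℕ => Pc.real (TwoBoxClusters n ⌈(n : ℝ) ^ ((7 : ℝ) / 6)⌉₊)) atTop (𝓝 0) :=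
  Iff.rfl

/-! ### Card `shell-product-kiss-positivity` -/

/-- FIRST LEMMA (a) of card 1 — the shell product at aspect `M` over the pairwise vertex-DISJOINT
closed shells `S(M^{2k} n, M^{2k+1} n)`, `k ≤ K`:
`P(A₂(n, M^{2K+1} n)) ≤ ∏_{k ≤ K} P(B(M^{2k} n, M^{2k+1} n))`
(consecutive closed shells would share the edges inside their common sphere, so every other one is
used: vertex-disjoint shells have disjoint edge sets, hence independent events under the product
measure; two distinct clusters of `Λ_m` crossing from `Λ_n` restrict — last visit to the inner sphere,
first visit to the outer — to two distinct shell-crossing clusters of each shell's own configuration).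
Provable now. -/
def ShellProduct : Prop :=
  ∀ M n K : ℕ, 2 ≤ M → 1 ≤ n →
    Pc.real (TwoBoxClusters n (M ^ (2 * K + 1) * n)) ≤
      ∏ k ∈ Finset.range (K + 1), Pc.real (TwoShellClusters (M ^ (2 * k) * n) (M ^ (2 * k + 1) * n))

/-- `NP_M`: non-proliferation at ONE bounded aspect `M` — with probability `≥ c` the shell `S(r, Mr)`
does not contain two distinct crossing clusters, for all large `r`. -/
def NonProliferation (M : ℕ) : Prop :=
  ∃ c : ℝ, 0 < c ∧ ∃ r₀ : ℕ, ∀ r : ℕ, r₀ ≤ r → Pc.real (TwoShellClusters r (M * r)) ≤ 1 - c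

/-- FIRST LEMMA (b) of card 1 — the transfer: non-proliferation at any bounded aspect gives the crux
(indeed `U(b)` for every `b > 0`, with a power-law rate). Provable now from `ShellProduct` (`A₂(n,·)` is antitone in the
outer radius; `M^{2K+1} n ≤ ⌈n^{7/6}⌉` with `K → ∞`) and `(1-c)^K → 0`. -/
def NP_implies_crux : Prop :=
  (∃ M : ℕ, 2 ≤ M ∧ NonProliferation M) → NearLinearTwoClusterDecay

/-- Sparse version actually needed: a `c`-good scale in every window of `L` consecutive dyadic scales. -/
def SparseNonProliferation : Prop :=
  ∃ c : ℝ, 0 < c ∧ ∃ L : ℕ, ∀ j : ℕ, ∃ i ∈ Finset.Ico j (j + L),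
    ∀ r ∈ Finset.Ico (2 ^ i) (2 ^ (i + 1)), Pc.real (TwoShellClusters r (2 * r)) ≤ 1 - c

def SparseNP_implies_crux : Prop := SparseNonProliferation → NearLinearTwoClusterDecay

/-! ### Card `first-cluster-exploration-independent-crossings-meet` -/

/-- The avoidable-pair event for two INDEPENDENT configurations `(ω, ω')` on the shell `S(r,R)`:
`ω` has a shell-crossing from `x`, and `ω'` has a shell-crossing path avoiding the vertex set of the
`ω`-shell-cluster of `x` (the set `{v | x ↔ v in S(r,R)}[ω]`). -/
def AvoidablePair (r R : ℕ) : Set (BondConfig (Site 3) × BondConfig (Site 3)) :=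
  {p | ∃ x ∈ sphere r, ∃ y ∈ sphere R, p.1 ∈ openConnIn (shell r R) x y ∧
      ∃ x' ∈ sphere r, ∃ y' ∈ sphere R,
        p.2 ∈ openConnIn (shell r R ∩ {v | p.1 ∉ openConnIn (shell r R) x v}) x' y'}

/-- `t_M(r) ≤ 1 - c`: Two Independent critical Crossings of the aspect-`M` shell Meet (TICM). -/
def TICM (M : ℕ) : Prop :=
  ∃ c : ℝ, 0 < c ∧ ∃ r₀ : ℕ, ∀ r : ℕ, r₀ ≤ r → (Pc.prod Pc).real (AvoidablePair r (M * r)) ≤ 1 - c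

/-- FIRST LEMMA (a) of card 2 — the exploration product at aspect `M` over the disjoint shells `S(M^{2k} n, M^{2k+1} n)`: `P(A₂(n, M^{2K+1} n)) ≤ ∏_{k≤K} t_M(M^{2k} n)`.
(Explore the clusters of the points of `Λ_n` inside `Λ_m` until the first crossing one, `C₁`; a second,
distinct crossing cluster uses only unexplored edges and avoids `V(C₁)`; in shell `k` the obstacle contains
a crossing cluster `D_k` of `ω|_{S_k}`; monotonicity in the obstacle and independence of the `ω|_{S_k}`
give the product of `E[max_D P_{ω'}(crossing of S_k avoiding D)] ≤ t(r_k)`.) Provable now. -/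
def ExplorationProduct : Prop :=
  ∀ M n K : ℕ, 2 ≤ M → 1 ≤ n →
    Pc.real (TwoBoxClusters n (M ^ (2 * K + 1) * n)) ≤
      ∏ k ∈ Finset.range (K + 1), (Pc.prod Pc).real (AvoidablePair (M ^ (2 * k) * n) (M ^ (2 * k + 1) * n))

/-- FIRST LEMMA (b) of card 2 — TICM gives the crux. -/
def TICM_implies_crux : Prop := (∃ M : ℕ, 2 ≤ M ∧ TICM M) → NearLinearTwoClusterDecay

/-! ### Engine statements of card 1 (per-shell inputs for `NonProliferation 2`) -/

/-- `Tight(k₀)`: at most `k₀` crossing clusters of `S(r,2r)` with probability `≥ c₀` (no `k₀+1` pairwise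
shell-disconnected crossings). -/
def Tight (k₀ : ℕ) : Prop :=
  ∃ c₀ : ℝ, 0 < c₀ ∧ ∃ r₀ : ℕ, ∀ r : ℕ, r₀ ≤ r →
    c₀ ≤ Pc.real {ω | ¬ ∃ x : Fin (k₀ + 1) → Site 3, ∃ y : Fin (k₀ + 1) → Site 3,
      (∀ i, x i ∈ sphere r ∧ y i ∈ sphere (2 * r) ∧ ω ∈ openConnIn (shell r (2 * r)) (x i) (y i)) ∧
      ∀ i j, i ≠ j → ω ∉ openConnIn (shell r (2 * r)) (x i) (x j)}

/-- `PivPos`: with probability `≥ c` the shell crossing has an OPEN PIVOTAL edge (a red bond): some open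
edge `e` such that closing it destroys every crossing. A red bond forbids two edge-disjoint crossings,
hence `PivPos → NonProliferation 2` in one line. -/
def PivPos : Prop :=
  ∃ c : ℝ, 0 < c ∧ ∃ r₀ : ℕ, ∀ r : ℕ, r₀ ≤ r →
    c ≤ Pc.real {ω | ∃ e ∈ ω, (∃ x ∈ sphere r, ∃ y ∈ sphere (2 * r), ω ∈ openConnIn (shell r (2 * r)) x y) ∧
      ∀ x ∈ sphere r, ∀ y ∈ sphere (2 * r), ω \ {e} ∉ openConnIn (shell r (2 * r)) x y}

def PivPos_implies_NP : Prop := PivPos → NonProliferation 2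

end

end Summit.CriticalPhenomena.PercolationContinuityZ3.Cruxes.NearLinearTwoClusterDecay.Sketch
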